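import Summits.BirchSwinnertonDyer.Rank2.F2MemberLocalData
import Literature.NumberTheory.EllipticCurves.PointCountEulerCriterion
import HarnessLib

/-!
# BirchSwinnertonDyer / CountingDoorF2AtThree — the DOOR FAMILY `Φ₀ ⊆ F₂` of the counting bridge
# (support item `CountingBridge`, stmt-BirchSwinnertonDyer-19484; cell bsd-rank2, seat eng GEN 4)

The support item `CountingBridge` of `route-BirchSwinnertonDyer-CountingDoorF2AtThree` (TWIN leaf
`PAdicBSDRankTwoPositiveProportion`, director-bsd ruling 2026-08-26T01:56:50Z) shrinks Bhargava–Ho's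
family `F₂` to a large subfamily `Φ₀` on which the per-member hypotheses of the door kernel at
`p = 3` (`Summit.BirchSwinnertonDyer.Rank2.doorKernel_at_three` /
`order_eq_two_at_three_of_rank_two`: good ordinary at `3`, irreducible `ρ̄₃`, an auxiliary
multiplicative prime `ℓ ≠ 3` with `3 ∤ v_ℓ(Δ_min)`) hold for EVERY member, by congruence
conditions alone. This file produces such a family as an existence theorem (no definition):

  `Φ₀ = F₂ ∩ {a ≡ (1,0,1,0) (mod 9)} ∩ {a ≡ (1,0,1,0) (mod 25)} ∩ {a ≡ (1,2,4,3) (mod 49)}`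

(conditions modulo `p²` at `p = 3, 5, 7`, none elsewhere — so `Φ₀` is large at every `p ≥ 8` and
every residue set is nonempty). The three classes are decided on their representatives by the
kernel: `y² + xy = x³ - x` (`Δ = 65`, `#E(𝔽₃) = 6`, `a₃ = -2`: good ordinary at `3`;
`ord₅ Δ = 1`: multiplicative at `5` with `ord₅ Δ_min = 1` on every globally minimal model) and
`y² + xy + 3y = x³ - 28x + 48` (`7 ∤ Δ = 4964`, `#E(𝔽₇) = 8`, `a₇ = 0`, `X² + 7` root-free mod
`3`: Mazur's Frobenius certificate, `ρ̄₃` irreducible), and transported to the whole class by the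
class-constancy lemmas of `Summits/BirchSwinnertonDyer/Rank2/F2MemberLocalData.lean` (seat lit
GEN 10). PARTITION: none — r_an ≥ 2, summit axis S0; TWIN (D-0056): n/a. B1 honesty: local
algebra of Weierstrass models and two point counts over `𝔽₃`, `𝔽₇`; nothing here mentions a
Selmer group, an `L`-value or the analytic rank.

References: M. Bhargava, W. Ho, arXiv:2207.03309 §1 [BhargavaHo2022]; B. Mazur, Invent. Math. 44
(1978) Prop. 6.3 (1) [Mazur1978]; J. H. Silverman, *AEC* (2009) VII.1, VII.5 [SilvermanAEC2009].
-/

set_option linter.dupNamespace false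

noncomputable section

open scoped Classical
open WeierstrassCurve Literature.NumberTheory.EllipticCurves
  Literature.NumberTheory.EllipticCurves.BhargavaHo2022
  Summit.BirchSwinnertonDyer.Rank2

namespace Summit.BirchSwinnertonDyer.BirchSwinnertonDyer.Theorems

/-! ### The representative at `3` and `5`: `a = (1, 0, 1, 0)`, `y² + xy = x³ - x`, `Δ = 65` -/

/-- The integer model of the member `a = (1, 0, 1, 0)` of `F₂` is `y² + xy = x³ - x`
(`[1, 0, 0, -1, 0]`). [cite: BhargavaHo2022, §1 (definition of F₂)] -/
theorem curveInt_rep₃ : (⟨1, 0, 1, 0⟩ : Params).curveInt = ⟨1, 0, 0, -1, 0⟩ := by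
  simp [Params.curveInt]

/-- Its discriminant is `65 = 5 · 13`. [cite: BhargavaHo2022, §1 (the discriminant polynomial Δ)] -/
theorem Δ_rep₃ : (⟨1, 0, 1, 0⟩ : Params).curveInt.Δ = 65 := by
  rw [curveInt_rep₃]
  simp [WeierstrassCurve.Δ, WeierstrassCurve.b₂, WeierstrassCurve.b₄, WeierstrassCurve.b₆,
    WeierstrassCurve.b₈]

/-- `#E(𝔽₃) = 6` for `y² + xy = x³ - x` (kernel-decided through
`WeierstrassCurve.natCard_point_eq_one_add_card` and `card_sol_eq_sum_euler`). [folklore] -/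
theorem card_rep₃_three :
    Nat.card (((⟨1, 0, 0, -1, 0⟩ : WeierstrassCurve ℤ).map
      (Int.castRingHom (ZMod 3))).toAffine.Point) = 6 := by
  rw [@WeierstrassCurve.natCard_point_eq_one_add_card (ZMod 3) (@ZMod.instField 3 ⟨by norm_num⟩) _ _ _
    (by decide +kernel), @card_sol_eq_sum_euler (ZMod 3) (@ZMod.instField 3 ⟨by norm_num⟩) _ _
    (by rw [ZMod.ringChar_zmod_n]; decide), ZMod.card]
  decide +kernel

/-- Hence `a₃ = 3 + 1 - 6 = -2` for the representative (good ORDINARY, anomalous, at `3`).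
[folklore] -/
theorem frobeniusTrace_rep₃_three :
    Literature.NumberTheory.Automorphic.frobeniusTrace (⟨1, 0, 1, 0⟩ : Params).curveInt 3 = -2 := by
  unfold Literature.NumberTheory.Automorphic.frobeniusTrace
    Literature.NumberTheory.Automorphic.numPointsMod
  rw [curveInt_rep₃, card_rep₃_three]
  norm_num

/-- `ord₅ Δ = ord₅ 65 = 1` for the representative. [folklore] -/
theorem padicValInt_five_Δ_rep₃ :
    padicValInt 5 (⟨1, 0, 1, 0⟩ : Params).curveInt.Δ = 1 := by
  haveI : Fact (Nat.Prime 5) := ⟨by norm_num⟩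
  rw [Δ_rep₃, padicValInt_eq_one_iff]
  norm_num

/-! ### The representative at `7`: `a = (1, 2, 4, 3)`, `y² + xy + 3y = x³ - 28x + 48`, `Δ = 4964` -/

/-- The integer model of the member `a = (1, 2, 4, 3)` of `F₂` is `y² + xy + 3y = x³ - 28x + 48`
(`[1, 0, 3, -28, 48]`). [cite: BhargavaHo2022, §1 (definition of F₂)] -/
theorem curveInt_rep₇ : (⟨1, 2, 4, 3⟩ : Params).curveInt = ⟨1, 0, 3, -28, 48⟩ := by
  simp [Params.curveInt]

/-- Its discriminant is `4964 = 2² · 17 · 73`. [cite: BhargavaHo2022, §1 (the discriminant polynomial Δ)] -/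
theorem Δ_rep₇ : (⟨1, 2, 4, 3⟩ : Params).curveInt.Δ = 4964 := by
  rw [curveInt_rep₇]
  simp [WeierstrassCurve.Δ, WeierstrassCurve.b₂, WeierstrassCurve.b₄, WeierstrassCurve.b₆,
    WeierstrassCurve.b₈]

/-- `#E(𝔽₇) = 8` for `y² + xy + 3y = x³ - 28x + 48` (kernel-decided). [folklore] -/
theorem card_rep₇_seven :
    Nat.card (((⟨1, 0, 3, -28, 48⟩ : WeierstrassCurve ℤ).map
      (Int.castRingHom (ZMod 7))).toAffine.Point) = 8 := by
  rw [@WeierstrassCurve.natCard_point_eq_one_add_card (ZMod 7) (@ZMod.instField 7 ⟨by norm_num⟩) _ _ _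
    (by decide +kernel), @card_sol_eq_sum_euler (ZMod 7) (@ZMod.instField 7 ⟨by norm_num⟩) _ _
    (by rw [ZMod.ringChar_zmod_n]; decide), ZMod.card]
  decide +kernel

/-- Hence `a₇ = 7 + 1 - 8 = 0` for the representative. [folklore] -/
theorem frobeniusTrace_rep₇_seven :
    Literature.NumberTheory.Automorphic.frobeniusTrace (⟨1, 2, 4, 3⟩ : Params).curveInt 7 = 0 := by
  unfold Literature.NumberTheory.Automorphic.frobeniusTrace
    Literature.NumberTheory.Automorphic.numPointsMod
  rw [curveInt_rep₇, card_rep₇_seven]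
  norm_num

/-- `X² - a₇ X + 7 = X² + 7` has no root modulo `3` (Mazur's Frobenius certificate for `ρ̄₃`).
[folklore] -/
theorem noroot_rep₇_three : ∀ t : ZMod 3, t ^ 2 - (0 : ZMod 3) * t + (7 : ZMod 3) ≠ 0 := by
  decide +kernel

/-! ### Reduction of a class modulo `p²` to the class modulo `p` -/

/-- If `(x : ZMod (p²)) = (y : ZMod (p²))` for integers `x`, `y`, then `(x : ZMod p) = (y : ZMod p)`.
[folklore] -/
theorem intCast_zmod_eq_of_sq {p : ℕ} {x y : ℤ} (h : (x : ZMod (p ^ 2)) = (y : ZMod (p ^ 2))) :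
    (x : ZMod p) = (y : ZMod p) := by
  have h' := congrArg (ZMod.castHom (dvd_pow_self p two_ne_zero) (ZMod p)) h
  rwa [map_intCast, map_intCast] at h'

/-! ### The door family -/

/-- **The door family.** There is a large subfamily `Φ₀` of `F₂` with a nonempty congruence
condition at every prime — namely `F₂ ∩ {a ≡ (1,0,1,0) (mod 9)} ∩ {a ≡ (1,0,1,0) (mod 25)} ∩
{a ≡ (1,2,4,3) (mod 49)}`, no condition elsewhere — all of whose members `E_a` have irreducible
`ρ̄₃` (one Frobenius certificate at the good prime `7`: `a₇ = 0`, `X² + 7` root-free mod `3`, for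
the representative `y² + xy + 3y = x³ - 28x + 48`), and have every globally minimal model good
ordinary at `3` (`a₃ = -2`, read off the representative `y² + xy = x³ - x`) and multiplicative at
the auxiliary prime `5` with `ord₅ Δ_min = 1` (`ord₅ Δ(a) = 1`, a condition mod `25`): the
hypotheses `hirr`, `hord`, `haux` of the door kernel at `p = 3` hold member-wise and
deterministically (class-constancy, `Rank2.F2Member.*`). [cite: BhargavaHo2022, §1 (large subfamilies defined by congruence conditions)] -/
theorem exists_doorFamily : ∃ Φ : CongruenceFamily₂, Φ.IsLarge ∧
    (∀ p : ℕ, p.Prime → (Φ.residues p).Nonempty) ∧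
    ∀ a : Params, Φ.Mem a → a.curve.HasIrreducibleModPGaloisRep 3 ∧
      ∀ (C : VariableChange ℚ) (hC : (C • a.curve).IsGloballyMinimal),
        @IsOrdinaryAt (C • a.curve) hC 3 _ ∧ ∃ ℓ : ℕ, ∃ _ : Fact ℓ.Prime, ℓ ≠ 3 ∧
          (C • a.curve).HasMultiplicativeReductionAtPrime ℓ ∧
          ¬ 3 ∣ padicValInt ℓ (@minimalDiscriminantInt (C • a.curve) hC) := by
  refine ⟨⟨fun _ ↦ 2, fun p ↦
    {r | (p = 3 ∨ p = 5 → r = (1, 0, 1, 0)) ∧ (p = 7 → r = (1, 2, 4, 3))}⟩, ?_, ?_, ?_⟩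
  · -- large: no condition at the primes `p ≥ 8`
    refine ⟨8, fun p hp _ a _ _ ↦ ?_⟩
    simp only [Set.mem_setOf_eq]
    refine ⟨?_, ?_⟩
    · rintro (rfl | rfl) <;> omega
    · rintro rfl; omega
  · -- nonempty residue sets: the representatives' residues
    intro p _
    by_cases h7 : p = 7
    · subst h7
      exact ⟨(1, 2, 4, 3), fun h ↦ by omega, fun _ ↦ rfl⟩
    · exact ⟨(1, 0, 1, 0), fun _ ↦ rfl, fun h ↦ absurd h h7⟩
  · -- member-wise local data at `3`, `5` and `7`
    intro a hmem
    have h3 := (hmem.2 3 Nat.prime_three).1 (Or.inl rfl)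
    have h5 := (hmem.2 5 (by norm_num)).1 (Or.inr rfl)
    have h7 := (hmem.2 7 (by norm_num)).2 rfl
    simp only [CongruenceFamily₂.residueOf, Prod.mk.injEq] at h3 h5 h7
    obtain ⟨h31, h32, h33, h34⟩ := h3
    obtain ⟨h51, h52, h53, h54⟩ := h5
    obtain ⟨h71, h72, h73, h74⟩ := h7
    -- the classes of the parameters modulo `3`, `25`, `7` are those of the representatives
    have e₁ : (a.a₁ : ZMod 3) = ((⟨1, 0, 1, 0⟩ : Params).a₁ : ZMod 3) :=
      intCast_zmod_eq_of_sq (p := 3) (by rw [h31]; simp)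
    have e₂ : (a.a₂ : ZMod 3) = ((⟨1, 0, 1, 0⟩ : Params).a₂ : ZMod 3) :=
      intCast_zmod_eq_of_sq (p := 3) (by rw [h32]; simp)
    have e₂' : (a.a₂' : ZMod 3) = ((⟨1, 0, 1, 0⟩ : Params).a₂' : ZMod 3) :=
      intCast_zmod_eq_of_sq (p := 3) (by rw [h33]; simp)
    have e₃ : (a.a₃ : ZMod 3) = ((⟨1, 0, 1, 0⟩ : Params).a₃ : ZMod 3) :=
      intCast_zmod_eq_of_sq (p := 3) (by rw [h34]; simp)
    have f₁ : (a.a₁ : ZMod (5 ^ 2)) = ((⟨1, 0, 1, 0⟩ : Params).a₁ : ZMod (5 ^ 2)) := by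
      rw [h51]; simp
    have f₂ : (a.a₂ : ZMod (5 ^ 2)) = ((⟨1, 0, 1, 0⟩ : Params).a₂ : ZMod (5 ^ 2)) := by
      rw [h52]; simp
    have f₂' : (a.a₂' : ZMod (5 ^ 2)) = ((⟨1, 0, 1, 0⟩ : Params).a₂' : ZMod (5 ^ 2)) := by
      rw [h53]; simp
    have f₃ : (a.a₃ : ZMod (5 ^ 2)) = ((⟨1, 0, 1, 0⟩ : Params).a₃ : ZMod (5 ^ 2)) := by
      rw [h54]; simp
    have g₁ : (a.a₁ : ZMod 7) = ((⟨1, 2, 4, 3⟩ : Params).a₁ : ZMod 7) :=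
      intCast_zmod_eq_of_sq (p := 7) (by rw [h71]; simp)
    have g₂ : (a.a₂ : ZMod 7) = ((⟨1, 2, 4, 3⟩ : Params).a₂ : ZMod 7) :=
      intCast_zmod_eq_of_sq (p := 7) (by rw [h72]; simp)
    have g₂' : (a.a₂' : ZMod 7) = ((⟨1, 2, 4, 3⟩ : Params).a₂' : ZMod 7) :=
      intCast_zmod_eq_of_sq (p := 7) (by rw [h73]; simp)
    have g₃ : (a.a₃ : ZMod 7) = ((⟨1, 2, 4, 3⟩ : Params).a₃ : ZMod 7) :=
      intCast_zmod_eq_of_sq (p := 7) (by rw [h74]; simp)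
    haveI : Fact (Nat.Prime 5) := ⟨by norm_num⟩
    haveI : Fact (Nat.Prime 7) := ⟨by norm_num⟩
    refine ⟨?_, fun C hC ↦ ?_⟩
    · -- irreducible `ρ̄₃`: Frobenius certificate at `7` on the class representative
      have h := F2Member.hasIrreducibleModPGaloisRep_smul_curve_of_cast_eq (a := a)
        (1 : VariableChange ℚ) 3 7 (by norm_num) g₁ g₂ g₂' g₃ (by rw [Δ_rep₇]; norm_num)
        (by rw [frobeniusTrace_rep₇_seven]; exact_mod_cast noroot_rep₇_three)
      rwa [one_smul] at h
    haveI := hC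
    refine ⟨F2Member.isOrdinaryAt_smul_curve a C 3 ?_ ?_, ?_⟩
    · rw [F2Member.dvd_Δ_iff_of_cast_eq e₁ e₂ e₂' e₃, Δ_rep₃]; norm_num
    · rw [F2Member.frobeniusTrace_eq_of_cast_eq e₁ e₂ e₂' e₃, frobeniusTrace_rep₃_three]; norm_num
    · exact F2Member.haux_smul_curve a C (ℓ := 5) le_rfl
        ((F2Member.padicValInt_Δ_eq_one_iff_of_cast_eq f₁ f₂ f₂' f₃).mpr padicValInt_five_Δ_rep₃)
        3 Nat.prime_three (by norm_num)

end Summit.BirchSwinnertonDyer.BirchSwinnertonDyer.Theorems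

end
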